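import Summits.CriticalPhenomena.PercolationContinuityZ3.Theorems.PercNearOneGluingNoHeavyLowerTailSunflowerMultiPetalKempeMarkedLemmaB
import HarnessLib
import HarnessLib.Audit

/-!
# `NoHeavyLowerTail` (crux stmt-CriticalPhenomena-4575): ONE-POINT MONOTONICITY OF `Q` FOR EVERY FINITE GRAPH — `Q(G − x) ≤ Q(G)` — and the discharge of
# the tree's obligation `MZQConnected` (kernel-checked)

Support file (seat `prim-l12-p2` gen 49; `--supports stmt-CriticalPhenomena-4575`; continuation of `…KempeMarkedLemmaB` (p609343: `MGraph.QcolM_isolate_le`) and of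
`…KempePinned` (p414773: `ctype_extCol`, `Qcol_sub_Qcol_induce`), `…KempeConnected` (p409076: `MZQConnected`)).  No `sorry`; nothing is asserted about the crux.

* `ctypeM_isolate_ofSimple_extCol` — the type of `(τ, x ↦ c)` in `(ofSimple G).isolate x` is the type of `τ` in the induced graph `G − x` (bridge between the
  same-vertex-type deletion `isolate` of the marked-multigraph layer and `SimpleGraph.induce {x}ᶜ`);
* `QcolM_isolate_ofSimple` — `Q((ofSimple G).isolate x) = 3·Qcol (G − x)`; `QcolM_ofSimple` — `Q(ofSimple G) = Qcol G`;
* **`Qcol_induce_le`** — `Qcol (G − x) ≤ Qcol G` for EVERY finite graph and EVERY vertex (no connectivity hypothesis), from `MGraph.QcolM_isolate_le`;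
* **`mzqConnected_holds : MZQConnected`** — the one-point obligation of p409076 is a theorem.
-/

namespace Summit.CriticalPhenomena.PercolationContinuityZ3.Theorems.SunflowerPartition.Kempe

open Finset

namespace MGraph

variable {V : Type*} [Fintype V] [LinearOrder V]

/-- **`isolate` versus `induce`**: the type of `(τ, x ↦ c)` in `(ofSimple G).isolate x` is the type of `τ` in `G − x`. [this work] -/
theorem ctypeM_isolate_ofSimple_extCol (G : SimpleGraph V) [DecidableRel G.Adj] (x : V) (τ : (({x}ᶜ : Set V)) → Fin 3) (c : Fin 3) :
    ((ofSimple G).isolate x).ctypeM (extCol x τ c) = ctype (G.induce ({x}ᶜ : Set V)) τ := by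
  have E : ∀ c₀ : Fin 3, ctAdd (ctype (G.induce ({x}ᶜ : Set V)) τ) (xPart c₀ (prof3 G x τ))
      = ctAdd (((ofSimple G).isolate x).ctypeM (extCol x τ c)) (xPart c₀ ((ofSimple G).profM x (extCol x τ c))) := by
    intro c₀
    have h := (ofSimple G).ctypeM_eq_ctAdd_isolate x (extCol x τ c₀)
    rw [extCol_self, ctypeM_ofSimple, (ofSimple G).ctypeM_isolate_extCol x τ c₀ c, (ofSimple G).profM_extCol x τ c₀ c] at h
    rw [← h]
    -- the two sides differ only in the (subsingleton) instances chosen for the subtype `{x}ᶜ`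
    convert (ctype_extCol G x τ c₀).symm using 3
  have h1 := E 1
  have h0 := E 0
  rw [xPart_one_eq, xPart_one_eq] at h1
  rw [xPart_zero_eq, xPart_zero_eq] at h0
  unfold ctAdd at h0 h1
  simp only [capAdd_zero_right, Prod.mk.injEq] at h0 h1
  exact (Prod.ext h1.1 (Prod.ext h0.2.1 h0.2.2)).symm

/-- `Qcol` of the induced graph as a sum over the colourings of `V ∖ {x}` (instance-robust restatement of `Qcol_induce_eq_sum`). [this work] -/
theorem Qcol_induce_eq_sum' (G : SimpleGraph V) (x : V) :
    Qcol (G.induce ({x}ᶜ : Set V)) = ∑ τ : (({x}ᶜ : Set V)) → Fin 3, qcol (G.induce ({x}ᶜ : Set V)) τ := by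
  unfold Qcol
  convert rfl

/-- **`Q((ofSimple G).isolate x) = 3·Qcol (G − x)`** (the isolated vertex is free: factor `3`). [this work] -/
theorem QcolM_isolate_ofSimple (G : SimpleGraph V) [DecidableRel G.Adj] (x : V) :
    ((ofSimple G).isolate x).QcolM = 3 * Qcol (G.induce ({x}ᶜ : Set V)) := by
  rw [((ofSimple G).isolate x).QcolM_eq_sum_extCol x, Qcol_induce_eq_sum' G x, mul_sum]
  refine sum_congr rfl fun τ _ => ?_
  rw [Fin.sum_univ_three, ctypeM_isolate_ofSimple_extCol G x τ 0, ctypeM_isolate_ofSimple_extCol G x τ 1,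
    ctypeM_isolate_ofSimple_extCol G x τ 2, lbW_ctype]
  ring

/-- **`Q(ofSimple G) = Qcol G`**. [this work] -/
theorem QcolM_ofSimple (G : SimpleGraph V) [DecidableRel G.Adj] : (ofSimple G).QcolM = Qcol G := by
  have e : ∀ σ : V → Fin 3, lbW ((ofSimple G).ctypeM σ) = qcol G σ := fun σ => by rw [ctypeM_ofSimple, lbW_ctype]
  unfold QcolM Qcol
  simp only [e]
  convert rfl

/-- **ONE-POINT MONOTONICITY OF `Q` FOR EVERY FINITE GRAPH**: `Qcol (G − x) ≤ Qcol G` for every vertex `x` (no connectivity hypothesis; from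
`MGraph.QcolM_isolate_le`, i.e. THEOREM R with all hypotheses discharged). [this work] -/
theorem Qcol_induce_le (G : SimpleGraph V) (x : V) : Qcol (G.induce ({x}ᶜ : Set V)) ≤ Qcol G := by
  classical
  have h1 := (ofSimple G).QcolM_isolate_le x
  rw [QcolM_isolate_ofSimple G x, QcolM_ofSimple G] at h1
  linarith

end MGraph

/-- **`MZQConnected` HOLDS** (the connected one-point obligation of p409076 is a theorem; the connectivity hypotheses are not needed). [this work] -/
theorem mzqConnected_holds : MZQConnected := by
  intro W _ G x _ _
  classical
  letI : LinearOrder W := LinearOrder.lift' (Fintype.equivFin W) (Fintype.equivFin W).injective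
  convert MGraph.Qcol_induce_le G x

end Summit.CriticalPhenomena.PercolationContinuityZ3.Theorems.SunflowerPartition.Kempe
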